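import Summits.ValiantsHypothesis.ValiantsHypothesis.Theses.GaugeDescent
import Literature.Computability.AlgebraicComplexity.RealTauConjectureDepthFour

/-!
# ValiantsHypothesis / GaugeDescent — item `ConstFreeToPrimeField` (stmt-ValiantsHypothesis-6639)

If the constant-free complexity of `per_n` over `ℤ` is p-bounded then, for every p-bounded `ℓ`, there
are p-bounded `r, s` and, for every `n`, a prime `p` with `2^{ℓ n} < p ≤ 2^{r n}` and
`L(per_n over ℤ/p) ≤ s n`: take `r = ℓ + 1` (Bertrand's postulate, `Nat.exists_prime_lt_and_le_two_mul`)
and `s n = τ-free complexity of per_n over ℤ` (a constant-free `ℤ`-circuit maps to a circuit over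
`ℤ/p`, `ArithCircuit.complexity_map_le_constantFreeComplexity`, and `map_perPoly`). HONEST FRAMING:
lattice bookkeeping of a dormant route; nothing here is progress on `VP ≠ VNP`.
-/

-- layout Summits/ValiantsHypothesis/ValiantsHypothesis forces the duplicated namespace component
set_option linter.dupNamespace false

namespace Summit.ValiantsHypothesis.ValiantsHypothesis.Theorems.GaugeDescent

open Literature.Computability.AlgebraicComplexity

/-- **Item `ConstFreeToPrimeField` (stmt-ValiantsHypothesis-6639).** [folklore] -/
theorem constFreeToPrimeField_proof : Theses.GaugeDescent.ConstFreeToPrimeField := by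
  unfold Theses.GaugeDescent.ConstFreeToPrimeField
  intro hτ ℓ hℓ
  refine ⟨fun n => ℓ n + 1, fun n => constantFreeComplexity (perPoly (Fin n) ℤ),
    IsPBounded.add_holds hℓ (IsPBounded.const 1), hτ, fun n => ?_⟩
  obtain ⟨p, hp, hlt, hle⟩ := Nat.exists_prime_lt_and_le_two_mul (2 ^ ℓ n) (pow_ne_zero _ two_ne_zero)
  refine ⟨p, hp, hlt, by rw [pow_succ]; omega, ?_⟩
  rw [← map_perPoly (Int.castRingHom (ZMod p))]
  exact ArithCircuit.complexity_map_le_constantFreeComplexity _ _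

end Summit.ValiantsHypothesis.ValiantsHypothesis.Theorems.GaugeDescent
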